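import Mathlib.GroupTheory.SpecificGroups.Cyclic
import Mathlib.GroupTheory.GroupAction.Basic
import Mathlib.Algebra.Group.Action.End
import Mathlib.Data.Nat.Factorial.Basic
import Mathlib.Data.Fintype.Perm
import Literature.IUT.HodgeTheaters.Labels
import HarnessLib

/-!
# The Remarks of [IUTchI] §4 on labels and symmetries: 4.7.1, 4.7.2 (i)–(iii), 4.9.1 (i)(ii),
# 4.9.2 (i)–(v), 4.9.3 (i)(ii) — abc-iut cell, layer L5 (wave-2 row W2-L5-02), statements-first

Mochizuki, *Inter-universal Teichmüller theory I: construction of Hodge theaters*, §4 "Multiplicative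
Combinatorial Teichmüller Theory", kurims May-2020 manuscript (lit key `paper:url-690e7b3c6199`),
Remarks 4.7.1, 4.7.2 (i)–(iii) (pp. 113–114), 4.9.1 (i)(ii) (pp. 116–117), 4.9.2 (i)–(v) (pp. 117–119),
4.9.3 (i)(ii) (p. 119) — thirteen census sub-items, each read on the page (companion file
`BaseRemarksSections.lean`: Remarks 4.3.1–4.3.3).  These Remarks are COMMENTARY on Examples 4.3–4.5 and
Propositions 4.7, 4.9 (typed by abc-iut-L5-t3 over the hypothesis structure `BaseThetaDatum`:
`BaseBridgeModels.lean`, `BaseHodgeTheaters.lean`, `Processions.lean`).  Following the layer rule for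
expository Remarks, each sub-item gets a `/-! -/` section carrying its locator; where a sub-item states a
CHECKABLE mechanism it is typed as a small theorem over Mathlib + `Labels.lean` and PROVED (the genre of
`no_compatible_bijection` = Rmk 4.2.1 in `Labels.lean`); pure prose is transcribed/summarised in the
section docstring and carries no declaration (census status "noted").  What is proved here:

* Rmk 4.7.1: the "collapsing of [i.e., failure of `F_l^⋇` to act freely on] `F_l^⋇`-orbits" versus the
  immunity of the torsor `LabCusp(†𝒟^⊚)`: an orbit map `j ↦ j · x` is injective iff the stabilizer of
  `x` is trivial (`Rmk471.smul_injective_iff_stabilizer_eq_bot`), so a fixed point of some `j ≠ 1`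
  collapses it (`Rmk471.collapse_of_smul_eq`) while a torsor never collapses (`Rmk471.torsor_immune`).
* Rmk 4.7.2 (ii): "the only common ground [of `†𝒟_>` and `†𝒟^⊚`] consists of an underlying set of
  cardinality `l^⋇`": the ordered label set `{1 < … < l^⋇}` and the cyclic group `F_l^⋇` have
  equinumerous underlying sets (`Rmk472.commonGround`); a torsor has the cardinality of its group
  (`Rmk472.torsor_card_eq`).
* Rmk 4.9.1 (ii): "restricting to the `F_l^⋇`-symmetry … amounts to the imposition of a cyclic
  structure on `J`": `F_l^⋇` is cyclic (`Rmk491.isCyclic_flStar`); a torsor structure embeds its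
  group faithfully into the symmetric group of `J` (`Rmk491.toPermHom_injective_of_torsor`); the full
  `𝔖_{l^⋇}`-symmetry is strictly larger as soon as `l ≥ 7` (`Rmk491.card_flStar_lt_card_perm`; at
  `l = 5`, `l^⋇ = 2` and the two symmetry groups both have order `2` — an edge case print does not
  exclude, recorded here, not flagged as an error).
* Rmk 4.9.2 (i): "synchronized" labels — a correspondence known up to a SINGLE element of `F_l^⋇` is
  always bijective and there are exactly `|F_l^⋇|` of them (`Rmk492.sync_bijective`, `Rmk492.card_sync`)
  — versus "nonsynchronized" labels, whose possibilities include non-bijective correspondences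
  (`Rmk492.exists_nonsync_not_bijective`; the full statement "every assignment" and Rmk 4.9.2 (iii) are
  abc-iut-L5-t3's `indepIndeterminacy_eq_univ` / `indepIndeterminacy_eq`, `Processions.lean`, NOT
  re-typed here).
* Rmk 4.9.3 (ii): using "`C_v`" instead of "`X→_v`" leads to nonsynchronized labels: the mechanism is
  Rmk 4.2.1's (`no_compatible_bijection`, `Labels.lean`) transported through the local/global
  bijections of label classes of cusps (`Rmk493.no_localGlobal_compatibility`).

NOT typed (prose only, see the sections): Rmk 4.7.2 (i) (Fig. 4.4), 4.7.2 (iii), 4.9.1 (i), 4.9.2 (ii),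
(iv), (v), 4.9.3 (i).  The number-theoretic input behind the mechanisms (Tchebotarev in Rmk 4.2.1,
[EtTh] Cor. 2.9) is not formalised, exactly as in `Labels.lean`.

Imports: Mathlib and `Literature.IUT.HodgeTheaters.Labels` (ACCEPTED p403780, built) only; no local
stubs; abc-iut-L5-t3's decl names occur in docstrings as cross-references only.  Record-only; the
bibliographic key of the series carries the D-0012 status, hence the tag form
[claim: Mochizuki2012, status: disputed] on every declaration; nothing here takes a side on
[IUTchIII] Cor. 3.12; typed ≠ discharged.
-/

namespace Literature.IUT.HodgeTheaters

/-! ### Remark 4.7.1 ([IUTchI] p. 113): `LabCusp(†𝒟^⊚)` is immune to the "collapsing" of `J ⥲ F_l^⋇`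

"The significance of the natural bijection `†ζ_⋆` of Proposition 4.7, (iii)" (abc-iut-L5-t3:
`BaseThetaDatum.Prop47iii`): to work with the global data `†𝒟^⊚` independently of the local data `†𝒟_>`,
`†𝒟_J` (Rmk 4.3.2 (b)), "by replacing the capsule index set `J` by the set of global label classes of cusps
`LabCusp(†𝒟^⊚)` via `†ζ_⋆`, one obtains an object … constructed via [i.e., "native to"] the global data that
is immune to the "collapsing" of `J ⥲ F_l^⋇` — i.e., of `F_l^⋇`-orbits of `𝕍^{±un}` — even at primes `v ∈ 𝕍`
of the sort discussed in Remark 4.2.1!  That is to say, this "collapsing" of [i.e., failure of `F_l^⋇` to act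
freely on] `F_l^⋇`-orbits of `𝕍^{±un}` is a characteristically global consequence of the global prime
decomposition trees discussed in Remark 4.3.1, (ii)" (cf. Rmk 4.9.3 (ii)).  MECHANISM (typed): for a group
`G` acting on a set, the association `j ↦ j · x` "collapses" (fails to be injective) exactly when `G` does
not act freely at `x`; an `F_l^⋇`-TORSOR such as `LabCusp(†𝒟^⊚)` (Example 4.3 (i); `IsTorsor`) never
collapses.  The arithmetic input (primes of `K` whose decomposition group in `Gal(K/F)` is large, Rmk 4.2.1,
Tchebotarev) is not formalised. -/

namespace Rmk471

variable {G X : Type*} [Group G] [MulAction G X]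

/-- **Remark 4.7.1, mechanism** ([IUTchI] p. 113): "collapsing" = "failure of `F_l^⋇` to act freely": the
orbit map `j ↦ j • x` is injective if and only if the stabilizer of `x` is trivial.
[claim: Mochizuki2012, status: disputed] -/
theorem smul_injective_iff_stabilizer_eq_bot (x : X) :
    Function.Injective (fun g : G => g • x) ↔ MulAction.stabilizer G x = ⊥ := by
  rw [Subgroup.eq_bot_iff_forall]
  constructor
  · intro h g hg
    exact h (by simpa using (MulAction.mem_stabilizer_iff.mp hg))
  · intro h g g' hgg'
    have : g'⁻¹ * g ∈ MulAction.stabilizer G x := by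
      rw [MulAction.mem_stabilizer_iff, mul_smul, show g • x = g' • x from hgg', inv_smul_smul]
    exact (inv_mul_eq_one.mp (h _ this)).symm

/-- Remark 4.7.1 ([IUTchI] p. 113): at a point fixed by some `j ≠ 1` (a prime of the sort discussed in Rmk
4.2.1) the labelling `j ↦ j • x` of its translates COLLAPSES — distinct labels give the same translate.
[claim: Mochizuki2012, status: disputed] -/
theorem collapse_of_smul_eq {g : G} {x : X} (hg : g ≠ 1) (hx : g • x = x) :
    ¬ Function.Injective (fun j : G => j • x) := fun h =>
  hg (h (by simpa using hx))

/-- Remark 4.7.1 ([IUTchI] p. 113): an object "native to the global data" carrying an `F_l^⋇`-TORSOR structure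
— `LabCusp(†𝒟^⊚)` — "is immune to the collapsing": every labelling `j ↦ j • c` is injective.
[claim: Mochizuki2012, status: disputed] -/
theorem torsor_immune {T : Type*} [MulAction G T] (h : IsTorsor G T) (c : T) :
    Function.Injective (fun j : G => j • c) := fun _ j' hjj' =>
  (h.existsUnique_smul_eq c (j' • c)).unique hjj' rfl

end Rmk471

/-! ### Remark 4.7.2 (i) ([IUTchI] p. 113, Fig. 4.4 p. 114) — expository, no declaration ("noted")

"At the level of labels [cf. the content of Proposition 4.7], the structure of a `𝒟`-ΘNF-Hodge theater may be
summarized via the diagram of Fig. 4.4": `[1 < 2 < … < j < … < (l^⋇−1) < l^⋇]` ↔ `†𝒟_>` (one `/^⋆`);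
`(/^⋆₁ /^⋆₂ … /^⋆_{l^⋇−1} /^⋆_{l^⋇})` ↔ the capsule `†𝒟_J`; the lower right-hand "`F_l^⋇`-cycle of `⋆`'s"
↔ `†𝒟^⊚`; "⇑ `φ^Θ_⋆`" ↔ the `𝒟`-Θ-bridge; "⇒ `φ^NF_⋆`" ↔ the `𝒟`-NF-bridge; the `/^⋆`'s denote
`𝒟`-prime-strips (abc-iut-L5-t3: `BaseThetaDatum.DThetaNFHodgeTheater`, fields `polyΘ`, `polyNF`). -/

/-! ### Remark 4.7.2 (ii) ([IUTchI] pp. 113–114): Frobenius-like `†𝒟_>` versus étale-like `†𝒟^⊚`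

The labels arising from `†𝒟_>` "correspond, ultimately, to various irreducible components in the special fiber
of a certain tempered covering of a ["geometric"!] Tate curve [a chain of copies of the projective line — cf.
[EtTh], Corollary 2.9]" and "are obtained by counting — in an intuitive, archimedean, additive fashion — the
number of irreducible components between a given irreducible component and the "origin"": GEOMETRIC, ADDITIVE,
ARCHIMEDEAN, hence FROBENIUS-LIKE (Cor. 3.8).  The `⋆`'s of `†𝒟^⊚` "arise, ultimately, from various primes of
an ["arithmetic"!] number field … permuted by the multiplicative group `F_l^⋇ = F_l^×/{±1}`, in a cyclic —
i.e., nonarchimedean — fashion": ARITHMETIC, MULTIPLICATIVE, NONARCHIMEDEAN, hence ÉTALE-LIKE (Rmk 4.3.2).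
"It is not surprising that the only "common ground" of these two fundamentally structurally different portions
consists of an underlying set of cardinality `l^⋇` [i.e., … `†𝒟_J`]."  TYPED: the ordered label set
`{1 < … < l^⋇}` (as `Fin l^⋇`; abc-iut-L5-t3's `FlStar.absVal` is the explicit labelling) and the cyclic
group `F_l^⋇` (`Rmk491.isCyclic_flStar`) share exactly an underlying set of cardinality `l^⋇`; an
`F_l^⋇`-torsor `J` has cardinality `l^⋇` (t3: `DThetaNFHodgeTheater.card_J` for the Hodge-theater index set). -/

namespace Rmk472

/-- **Remark 4.7.2 (ii)** ([IUTchI] p. 114): "the only "common ground" … consists of an underlying set of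
cardinality `l^⋇`" — the additive/ordered labels `{1 < 2 < … < l^⋇}` and the multiplicative/cyclic `F_l^⋇`
have equinumerous underlying sets (`l` an odd prime). [claim: Mochizuki2012, status: disputed] -/
theorem commonGround (l : ℕ) [Fact l.Prime] (hl : l ≠ 2) : Nonempty (FlStar l ≃ Fin (lStar l)) := by
  classical
  haveI := Fintype.ofFinite (FlStar l)
  refine ⟨Fintype.equivFinOfCardEq ?_⟩
  rw [← Nat.card_eq_fintype_card, card_flStar l hl]

/-- Remark 4.7.2 (ii) ([IUTchI] p. 114): a (nonempty) torsor — such as the capsule index set `J` with its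
`F_l^⋇`-torsor structure (Prop. 4.9 (i)) — has the cardinality of its structure group, here `l^⋇`.
[claim: Mochizuki2012, status: disputed] -/
theorem torsor_card_eq {G T : Type*} [Group G] [MulAction G T] [Nonempty T] (h : IsTorsor G T) :
    Nat.card T = Nat.card G :=
  (Nat.card_congr (h.orbitEquiv (Classical.arbitrary T))).symm

end Rmk472

/-! ### Remark 4.7.2 (iii) ([IUTchI] p. 114) — expository, no declaration ("noted")

"The bijection `†ζ_⋆` — or, perhaps more appropriately, its inverse `(†ζ_⋆)⁻¹ : J ⥲ LabCusp(†𝒟^⊚)` — may be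
thought of as relating arithmetic [the elements of `J` as collections of primes of a number field] to geometry
[the elements of `LabCusp(†𝒟^⊚)` as the [geometric!] cusps of the hyperbolic orbicurve]": "`(†ζ_⋆)⁻¹` may be
thought of as a sort of "combinatorial Kodaira–Spencer morphism" [cf. [HASurI], §1.4]" (cf. Rmk 4.9.2 (iv)). -/

/-! ### Remark 4.9.1 (i) ([IUTchI] pp. 116–117) — expository, no declaration ("noted")

"Ultimately [cf. [IUTchII], §2] we shall be interested in evaluating the étale theta function of [EtTh] … at
the various `𝒟`-prime-strips of `†𝒟_J`, in the fashion stipulated by the labels discussed in Proposition 4.7,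
(i)"; these values will be used to construct arithmetic line bundles whose arithmetic degrees ("log-volumes")
are to be computed; "in order to compute these global log-volumes, it is necessary to be able to compare the
log-volumes that arise at `𝒟`-prime-strips with different labels.  It is for this reason that the non-labeled
output data of the functors of Proposition 4.9, (i), (ii), (iii) [cf. also Proposition 4.11, (i), (ii)] …
are of crucial importance": they "make possible the comparison of objects [e.g., log-volumes] constructed
relative to different labels"; processions (Prop. 4.11) perform such comparisons "in a fashion that minimizes
the label indeterminacy that arises" (abc-iut-L5-t3: `factorial_lStar_lt_pow`, `Processions.lean`). -/

/-! ### Remark 4.9.1 (ii) ([IUTchI] p. 117): the `F_l^⋇`-symmetry versus the `𝔖_{l^⋇}`-symmetry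

"Since the `F_l^⋇`-symmetry that appears in Proposition 4.9, (i), is transitive, … one may use this action to
perform comparisons as discussed in (i)" — "What is the difference between this `F_l^⋇`-symmetry and the
`𝔖_{l^⋇}`-symmetry of … Proposition 4.9, (ii), (iii)?  In a word, restricting to the `F_l^⋇`-symmetry …
amounts to the imposition of a "cyclic structure" on the index set `J` [i.e., a structure of `F_l^⋇`-torsor
on `J`]": it "allows comparison between … distinct members of this index set `J`, without disturbing the
cyclic structure on `J`" ("a combinatorial manifestation of the link to the global object `†𝒟^⊚`"), whereas
"in order to compare these `𝒟`-prime-strips indexed by `J` "in the absolute" to `𝒟`-prime-strips that have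
nothing to do with `J`, it is necessary to "forget the cyclic structure on `J`"" — "precisely what is
achieved by … working with the "full `𝔖_{l^⋇}`-symmetry"".  TYPED: `F_l^⋇` is a cyclic group; a torsor
structure is a FAITHFUL embedding of the structure group into the symmetric group `𝔖_J` (which itself acts
transitively: Mathlib's `MulAction.IsPretransitive (Equiv.Perm J) J`); and the full symmetry is strictly
larger than the cyclic one once `l ≥ 7` (`l^⋇ ≥ 3`). -/

namespace Rmk491

/-- **Remark 4.9.1 (ii)** ([IUTchI] p. 117): the "cyclic structure" — `F_l^⋇ = F_l^×/{±1}` is a cyclic group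
(`l` prime). [claim: Mochizuki2012, status: disputed] -/
theorem isCyclic_flStar (l : ℕ) [Fact l.Prime] : IsCyclic (FlStar l) :=
  isCyclic_of_surjective (QuotientGroup.mk' (unitsPlusMinus l)) (QuotientGroup.mk'_surjective _)

/-- Remark 4.9.1 (ii) ([IUTchI] p. 117): "a structure of `F_l^⋇`-torsor on `J`" embeds the structure group
FAITHFULLY into the symmetric group of `J` — restricting from the `𝔖_{l^⋇}`-symmetry to the `F_l^⋇`-symmetry
is restricting to this simply transitive subgroup. [claim: Mochizuki2012, status: disputed] -/
theorem toPermHom_injective_of_torsor {G T : Type*} [Group G] [MulAction G T] [Nonempty T]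
    (h : IsTorsor G T) : Function.Injective (MulAction.toPermHom G T) := fun g g' hgg' =>
  Rmk471.torsor_immune h (Classical.arbitrary T) (by simpa using Equiv.congr_fun hgg' _)

/-- Remark 4.9.1 (ii) ([IUTchI] p. 117): the "full `𝔖_{l^⋇}`-symmetry" is strictly larger than the
`F_l^⋇`-symmetry as soon as `l ≥ 7` (then `l^⋇ ≥ 3` and `l^⋇ < l^⋇ !`).  At `l = 5` one has `l^⋇ = 2` and
both groups have order `2` (recorded, not excluded by print). [claim: Mochizuki2012, status: disputed] -/
theorem card_flStar_lt_card_perm (l : ℕ) [Fact l.Prime] (hl : 7 ≤ l) :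
    Nat.card (FlStar l) < Nat.card (Equiv.Perm (FlStar l)) := by
  classical
  haveI := Fintype.ofFinite (FlStar l)
  have hl2 : l ≠ 2 := by omega
  have h3 : 3 ≤ lStar l := by unfold lStar; omega
  rw [Nat.card_eq_fintype_card (α := Equiv.Perm (FlStar l)), Fintype.card_perm,
    ← Nat.card_eq_fintype_card, card_flStar l hl2]
  exact Nat.lt_factorial_self h3

end Rmk491

/-! ### Remark 4.9.2 (i) ([IUTchI] pp. 117–118, Fig. 4.5): synchronized versus nonsynchronized labels

"The various elements of the index set of the capsule of `𝒟`-prime-strips of a `𝒟`-NF-bridge are synchronized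
in their correspondence with the labels "`1, 2, …, l^⋇`", in the sense that this correspondence is completely
determined up to composition with the action of an element of `F_l^⋇`.  In particular, this correspondence is
always bijective" — "an important consequence of the fact that the number field in question is represented in
the `𝒟`-NF-bridge via a single copy … of `𝒟^⊚`".  If instead each `𝒟`-prime-strip of `†𝒟_J` had "its own
"independent globalization", i.e., copy of `𝒟^⊚`", related by a copy of `φ^NF_j` known only up to the action
of an element of `F_l^⋇`, then each "•" of Fig. 4.5 "is subject … to an independent indeterminacy concerning
the label `∈ F_l^⋇` to which it is associated.  In particular, the set of all possibilities for each association
includes correspondences between … `J` … and the set of labels `F_l^⋇` which fail to be bijective"; and since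
`F_l^⋇` "also acts faithfully on conjugates of the cusp `ε`" (Example 4.3 (i)), "working with nonsynchronized
labels" is inconsistent with the construction of "the crucial bijection `†ζ_⋆`" of Prop. 4.7 (iii).  TYPED
below (abstractly, for a labelling `χ : J → G`); "every assignment occurs" in the nonsynchronized case is
abc-iut-L5-t3's `indepIndeterminacy_eq_univ` (`Processions.lean`); the structural fact "†χ is a bijection"
is t3's `BaseThetaDatum.DThetaBridge.χ` (Prop. 4.7 (i)); faithfulness on `LabCusp` = `Rmk471.torsor_immune`. -/

namespace Rmk492

variable {G J : Type*} [Group G]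

/-- **Remark 4.9.2 (i), synchronized** ([IUTchI] p. 117): a correspondence `J → F_l^⋇` known up to "composition
with the action of an element of `F_l^⋇`" — i.e. `j ↦ g · χ(j)` for a SINGLE `g` — stays bijective when `χ` is.
[claim: Mochizuki2012, status: disputed] -/
theorem sync_bijective (χ : J ≃ G) (g : G) : Function.Bijective (fun j => g * χ j) :=
  (χ.trans (Equiv.mulLeft g)).bijective

/-- Remark 4.9.2 (i) with Prop. 4.9 (i) ([IUTchI] pp. 116–117): the synchronized possibilities
`{j ↦ g · χ(j)}_{g ∈ F_l^⋇}` number exactly `|F_l^⋇|` ("a total of precisely `l^⋇` possibilities", p. 116),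
for `J` nonempty. [claim: Mochizuki2012, status: disputed] -/
theorem card_sync [Nonempty J] (χ : J → G) :
    Nat.card (Set.range fun (g : G) (j : J) => g * χ j) = Nat.card G := by
  refine (Nat.card_congr (Equiv.ofInjective _ fun g g' hgg' => ?_)).symm
  simpa using congr_fun hgg' (Classical.arbitrary J)

/-- **Remark 4.9.2 (i), nonsynchronized** ([IUTchI] p. 118, Fig. 4.5): with an INDEPENDENT indeterminacy at
each index, "the set of all possibilities for each association includes correspondences between the index set
`J` … and the set of labels `F_l^⋇` which fail to be bijective" — e.g. a constant one, as soon as `J` has two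
elements. [claim: Mochizuki2012, status: disputed] -/
theorem exists_nonsync_not_bijective (χ : J → G) (hJ : ∃ j j' : J, j ≠ j') :
    ∃ f ∈ {f : J → G | ∃ g : J → G, ∀ j, f j = g j * χ j}, ¬ Function.Bijective f := by
  obtain ⟨j, j', hjj'⟩ := hJ
  refine ⟨fun _ => 1, ⟨fun i => (χ i)⁻¹, fun i => by simp⟩, fun hf => hjj' (hf.1 rfl)⟩

end Rmk492

/-! ### Remark 4.9.2 (ii) ([IUTchI] p. 118) — expository, no declaration ("noted")

"The "single copy" of `𝒟^⊚` may also be thought of as a "single connected component", hence — from the point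
of view of Galois categories — as a "single basepoint"." -/

/-! ### Remark 4.9.2 (iii) ([IUTchI] p. 118) — typed by abc-iut-L5-t3, indexed here only

"Since the natural action of `F_l^⋇` on `F_l^⋇` is transitive, one obtains the same "set of all possibilities
for each association", regardless of whether one considers independent `F_l^⋇`-indeterminacies at each index of
`J` or independent `𝔖_{l^⋇}`-indeterminacies at each index of `J`": PROVED by abc-iut-L5-t3 as
`indepIndeterminacy_eq` (and `indepIndeterminacy_eq_univ`) in `Processions.lean` (staged, filing behind
`BaseThetaDatum.lean`); one declaration per node — not re-typed here. -/

/-! ### Remark 4.9.2 (iv) ([IUTchI] p. 118) — expository, no declaration ("noted")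

"The synchronized indeterminacy [cf. (i)] exhibited by a `𝒟`-NF-bridge — i.e., … the crucial bijection `†ζ_⋆`
of Proposition 4.7, (iii) — may be thought of as a sort of combinatorial model of the notion of a "holomorphic
structure".  By contrast, the nonsynchronized indeterminacies discussed in (i) may be thought of as a sort of
combinatorial model of the notion of a "real analytic structure""; the theme "how a given combinatorial
holomorphic structure is 'embedded' within its underlying combinatorial real analytic structure" is "very much
in line with the spirit of classical complex Teichmüller theory". -/

/-! ### Remark 4.9.2 (v) ([IUTchI] pp. 118–119) — expository, no declaration ("noted")

"The main results of the "multiplicative combinatorial Teichmüller theory" developed in the present §4 may be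
summarized as follows: (a) globalizability of labels, in a fashion that is independent of local structures
[cf. Remark 4.3.2, (b); Proposition 4.7, (iii)]; (b) comparability of distinct labels [cf. Proposition 4.9;
Remark 4.9.1, (i)]; (c) absolute comparability [cf. Proposition 4.9, (ii), (iii); Remark 4.9.1, (ii)];
(d) minimization of label indeterminacy — without sacrificing the symmetry necessary to perform comparisons! —
via processions [cf. Proposition 4.11, (i), (ii)]." -/

/-! ### Remark 4.9.3 (i) ([IUTchI] p. 119) — expository, no declaration ("noted")

To apply the mono-anabelian theory of [AbsTopIII] to the local and global arithmetic fundamental groups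
(isomorphs of `Π_{C_K}`, `Π_v` for `v ∈ 𝕍^non`) of a `𝒟`-ΘNF-Hodge theater (Rmk 4.3.2) "it is of essential
importance to have available not only the absolute Galois groups of the various local and global base fields
involved, but also the geometric fundamental groups that lie inside": "it is precisely the outer Galois action
of the absolute Galois group of the base field on the geometric fundamental group that allows one to reconstruct
the ring structures group-theoretically in a fashion that is compatible with localization/globalization
operations as shown in Fig. 4.3" (the "entrusting of arithmetic moduli", [AbsTopIII] Rmk 5.10.3 (i), analogous
to the Kodaira–Spencer isomorphism of an indigenous bundle; cf. Rmk 4.7.2 (iii)). -/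

/-! ### Remark 4.9.3 (ii) ([IUTchI] p. 119): why "`X→_v`" and not "`C_v`" in Examples 3.3, 3.4

"Localization/globalization operations as shown in Fig. 4.3 give rise, when applied to the various geometric
fundamental groups involved, to various bijections between local and global sets of label classes of cusps.
Now suppose that one uses "`C_v`" instead of "`X→_v`" in the definition of "`𝒟_v`" in Examples 3.3, 3.4.  Then
the existence of `v ∈ 𝕍` of the sort discussed in Remark 4.2.1, together with the condition of compatibility
with localization/globalization operations … — where we take (`v` of Fig. 4.3) := (`v` of Remark 4.2.1),
(`v'` of Fig. 4.3) := (`w` of Remark 4.2.1) — imply that, at a combinatorial level, one is led … to a situation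
involving nonsynchronized labels [cf. Fig. 4.5], which … is incompatible with the construction of the crucial
bijection `†ζ_⋆` of Proposition 4.7, (iii)."  MECHANISM (typed): gluing the local-to-global bijections at `v`
(automorphisms acting transitively on the local label classes — the `C_v`-phenomenon of Rmk 4.2.1) and at
`w ∈ 𝕍^bad` (automorphisms acting trivially, [EtTh] Cor. 2.9) gives a bijection between the local label sets
that would have to absorb independent automorphisms at `v` — impossible by `no_compatible_bijection`
(`Labels.lean`).  The existence of such `v` (Tchebotarev) is not formalised. -/

namespace Rmk493

/-- **Remark 4.9.3 (ii), mechanism** ([IUTchI] p. 119; Rmk 4.2.1 p. 98): if the automorphisms at `v` act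
transitively on a local label set `T_v` with at least two elements, no pair of local-to-global bijections
`T_v ≃ T`, `T_w ≃ T` of label classes of cusps can be compatible with all of them (independent — "nonsynchronized"
— indeterminacies at `v`). [claim: Mochizuki2012, status: disputed] -/
theorem no_localGlobal_compatibility {A Tv Tw T : Type*} [Group A] [MulAction A Tv]
    [MulAction.IsPretransitive A Tv] (hT : ∃ s s' : Tv, s ≠ s') (bv : Tv ≃ T) (bw : Tw ≃ T) :
    ¬ ∀ (a : A) (t : Tv), bw.symm (bv (a • t)) = bw.symm (bv t) :=
  no_compatible_bijection hT (bv.trans bw.symm)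

end Rmk493

end Literature.IUT.HodgeTheaters
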